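import Summits.ResolutionOfSingularities.ResolutionOfSingularities.Theorems.WildQuotientsSummitReductionStubPairOrbitBlowupCentreLocalLemmas8
import Summits.ResolutionOfSingularities.ResolutionOfSingularities.Theorems.WildQuotientsSummitReductionStubPairQuasiSplitBaseChangeLevels
import HarnessLib

/-!
# `WildQuotients.SummitReduction` (stmt-ResolutionOfSingularities-16324), line `FramePerfect`:
# the engine of the geometric chart comparison — completed local rings of a base change from a
# level-bijective pair (algebra of stub `stub_pair_orbitBlowupCentreLocal`, file 9)

Route `ResolutionOfSingularities/WildQuotients`, crux `SummitReduction`; helper file of stub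
`stub_pair_orbitBlowupCentreLocal` (C2: de Jong 1996, 3.4 Claim (ii) over the orbit centre, with
quasi-splitness upstairs — de Jong 1997, proof of Prop. 5.11 ¶1). At a point `x'` of the blown-up
curve over the centre, files 1–6 give a common completion `R̂` of the fibre local ring
`B = 𝒪_{X₁,x'}/𝔪_y𝒪_{X₁,x'}` and of a local ring `C` of the chart model `κ(y)[x, y]/(xy - ā)`
("the special fibre intersected with this chart … is the spectrum of the ring `k[u, t₁']/(ut₁')`",
de Jong 1996, p. 64), i.e. ring maps `g₁ : B → R̂ ← C : g₂` over `l = κ(y)` with bijective levels.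
What clauses (H4)/(H2) of the stub need is the comparison AFTER a field extension `l'/l` (a finite
purely inseparable one for smoothness, the algebraically closed `K` of a geometric fibre for (H2)):
this file PROVES, hypothesis-free,

* `exists_localCpl_localization_baseChange_equiv` — **for every prime `𝔑` of `l' ⊗_l B` over
  `𝔪_B` there is a prime `𝔑'` of `l' ⊗_l C` over `𝔪_C` with `((l' ⊗_l B)_𝔑)^ ≅ ((l' ⊗_l C)_{𝔑'})^`
  compatibly with `l'`**, `𝔑'` maximal if `𝔑` is, and `l'`-rational if `𝔑` is: the base changes
  `l' ⊗ B → l' ⊗ R̂ ← l' ⊗ C` are level-bijective (`levelBijective_lTensor`, file `…Levels` of stub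
  QS), primes over the level ideals correspond and level-bijectivity localizes and completes
  (file 8: `exists_isPrime_comap_eq_of_levelBijective`, `levelBijective_localization`,
  `exists_localCpl_equiv_of_levelBijective_pair`).

Regularity, Krull dimension and the residue field being invariants of the completion, this reduces
the local structure of the geometric fibres of the blown-up curve over the centre to that of the
models `K[x, y]/(xy - ā)` (`AlterationsSemiStableCodimTwoBlowupFibreModels`).
-/

set_option linter.dupNamespace false

noncomputable section

open IsLocalRing TensorProduct
open Literature.AlgebraicGeometry.Resolution

namespace Summit.ResolutionOfSingularities.ResolutionOfSingularities.Theorems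

universe u

section Engine

variable {l : Type u} (l' : Type u) [Field l] [Field l'] [Algebra l l']
  {B C Rh : Type u} [CommRing B] [CommRing C] [CommRing Rh] [IsLocalRing B] [IsLocalRing C]
  [IsLocalRing Rh] [Algebra l B] [Algebra l C] [Algebra l Rh]
  (g₁ : B →ₐ[l] Rh)
  (h₁ : (maximalIdeal B).map g₁.toRingHom = maximalIdeal Rh)
  (hb₁ : ∀ n, Function.Bijective
    (Ideal.quotientMap (((maximalIdeal B) ^ n).map g₁.toRingHom) g₁.toRingHom Ideal.le_comap_map))

omit [IsLocalRing C] [Algebra l C] in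
include h₁ hb₁ in
/-- **Base change of a level-bijective map into a local ring**: for `g : B → R̂` over `l` with
bijective levels `B/𝔪_Bⁿ → R̂/𝔪ⁿ` (`𝔪_B R̂ = 𝔪`), the base change `l' ⊗ g` maps `𝔪_B(l' ⊗ B)`
onto `𝔪(l' ⊗ R̂)` and has bijective levels for these ideals (`levelBijective_lTensor`). [folklore] -/
theorem levelBijective_baseChange_maximalIdeal :
    ((maximalIdeal B).map (tensorInr l l' B)).map
        (Algebra.TensorProduct.map (AlgHom.id l' l') g₁).toRingHom =
      (maximalIdeal Rh).map (tensorInr l l' Rh) ∧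
    ∀ n, Function.Bijective (Ideal.quotientMap
      ((((maximalIdeal B).map (tensorInr l l' B)) ^ n).map
        (Algebra.TensorProduct.map (AlgHom.id l' l') g₁).toRingHom)
      (Algebra.TensorProduct.map (AlgHom.id l' l') g₁).toRingHom Ideal.le_comap_map) := by
  set G₁ := (Algebra.TensorProduct.map (AlgHom.id l' l') g₁).toRingHom with hG₁
  have hIJ : ((maximalIdeal B).map (tensorInr l l' B)).map G₁ = (maximalIdeal Rh).map (tensorInr l l' Rh) := by
    rw [Ideal.map_map, hG₁, map_id_comp_tensorInr, ← Ideal.map_map, h₁]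
  refine ⟨hIJ, fun n => ?_⟩
  have hb₁' : ∀ n, Function.Bijective (Ideal.quotientMap ((maximalIdeal Rh) ^ n) g₁.toRingHom
      (pow_le_comap_pow_of_map_le _ h₁.le n)) := fun n =>
    (bijective_quotientMap_congr (by rw [Ideal.map_pow, h₁]) g₁.toRingHom rfl Ideal.le_comap_map
      (pow_le_comap_pow_of_map_le _ h₁.le n)).mp (hb₁ n)
  have h := levelBijective_lTensor l' g₁ (maximalIdeal B) (maximalIdeal Rh) h₁.le hb₁' n
  exact (bijective_quotientMap_congr (by rw [Ideal.map_pow, hIJ]) G₁ rfl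
    (pow_le_comap_pow_of_map_le _ (map_map_tensorInr_le l' g₁ _ _ h₁.le) n) Ideal.le_comap_map).mp h

end Engine

section Main

/-- **Rationality passes between the two sides**: for ring maps `G₁ : D₁ → E`, `G₂ : D₂ → E` of
`l'`-algebras with `D₁ → E/J` onto for an ideal `J ⊆ 𝔐`, if `l' → D₁/G₁⁻¹𝔐` is onto then so is
`l' → D₂/G₂⁻¹𝔐`. [folklore] -/
theorem surjective_algebraMap_quotient_comap_of_surjective (l' : Type u) [Field l'] {D₁ D₂ E : Type u}
    [CommRing D₁] [CommRing D₂] [CommRing E] [Algebra l' D₁] [Algebra l' D₂] [Algebra l' E]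
    (G₁ : D₁ →ₐ[l'] E) (G₂ : D₂ →ₐ[l'] E) {J : Ideal E} (𝔐 : Ideal E) (hJ𝔐 : J ≤ 𝔐)
    (hsurj : Function.Surjective ((Ideal.Quotient.mk J).comp G₁.toRingHom))
    (h : Function.Surjective (algebraMap l' (D₁ ⧸ 𝔐.comap G₁.toRingHom))) :
    Function.Surjective (algebraMap l' (D₂ ⧸ 𝔐.comap G₂.toRingHom)) := by
  intro z
  obtain ⟨d₂, rfl⟩ := Ideal.Quotient.mk_surjective z
  -- `G₂ d₂ ≡ G₁ d₁ (mod J)` for some `d₁`, and `d₁ ≡ c (mod G₁⁻¹𝔐)` for some `c ∈ l'`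
  obtain ⟨d₁, hd₁⟩ := hsurj (Ideal.Quotient.mk J (G₂ d₂))
  obtain ⟨c, hc⟩ := h (Ideal.Quotient.mk _ d₁)
  refine ⟨c, ?_⟩
  have key : ∀ (D : Type u) [CommRing D] [Algebra l' D] (I : Ideal D),
      algebraMap l' (D ⧸ I) c = Ideal.Quotient.mk I (algebraMap l' D c) := fun D _ _ I => rfl
  rw [key, Ideal.Quotient.mk_eq_mk_iff_sub_mem, Ideal.mem_comap, map_sub, AlgHom.toRingHom_eq_coe,
    RingHom.coe_coe, AlgHom.commutes]
  rw [key, Ideal.Quotient.mk_eq_mk_iff_sub_mem, Ideal.mem_comap, map_sub, AlgHom.toRingHom_eq_coe,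
    RingHom.coe_coe, AlgHom.commutes] at hc
  rw [RingHom.comp_apply, Ideal.Quotient.mk_eq_mk_iff_sub_mem, AlgHom.toRingHom_eq_coe,
    RingHom.coe_coe] at hd₁
  have h1 : algebraMap l' E c - G₂ d₂ = (algebraMap l' E c - G₁ d₁) + (G₁ d₁ - G₂ d₂) := by ring
  rw [h1]
  exact 𝔐.add_mem hc (hJ𝔐 hd₁)

/-- **The engine of the geometric chart comparison.** Let `B`, `C` be local `l`-algebras mapping
compatibly with `l` into a local ring `R̂` by `g₁`, `g₂` with `𝔪_B R̂ = 𝔪 = 𝔪_C R̂` and bijective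
levels `B/𝔪_Bⁿ ≅ R̂/𝔪ⁿ ≅ C/𝔪_Cⁿ` (in the application: `R̂` a common completion of the fibre local
ring `B` of the blown-up curve and of the local ring `C` of the chart model `κ[x, y]/(xy - ā)`).
Then for every field extension `l'/l` and every prime `𝔑` of `l' ⊗_l B` over `𝔪_B` there is a
prime `𝔑'` of `l' ⊗_l C` over `𝔪_C`, maximal if `𝔑` is, `l'`-rational if `𝔑` is, with
**`((l' ⊗_l B)_𝔑)^ ≅ ((l' ⊗_l C)_{𝔑'})^` compatibly with `l'`**: the base changes
`l' ⊗ B → l' ⊗ R̂ ← l' ⊗ C` are level-bijective (`levelBijective_lTensor`), the primes over the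
level ideals correspond (`exists_isPrime_comap_eq_of_levelBijective`), level-bijectivity
localizes (`levelBijective_localization`), and a level-bijective pair of local rings has
isomorphic completions (`exists_localCpl_equiv_of_levelBijective_pair`).
[cite: DeJong1996, 3.4 Claim (ii), p. 64] [cite: DeJong1997, proof of Prop. 5.11, p. 618] -/
theorem exists_localCpl_localization_baseChange_equiv {l : Type u} (l' : Type u) [Field l] [Field l']
    [Algebra l l'] {B C Rh : Type u} [CommRing B] [CommRing C] [CommRing Rh] [IsLocalRing B]
    [IsLocalRing C] [IsLocalRing Rh] [Algebra l B] [Algebra l C] (g₁ : B →+* Rh) (g₂ : C →+* Rh)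
    (hcomp : ∀ c : l, g₁ (algebraMap l B c) = g₂ (algebraMap l C c))
    (h₁ : (maximalIdeal B).map g₁ = maximalIdeal Rh) (h₂ : (maximalIdeal C).map g₂ = maximalIdeal Rh)
    (hb₁ : ∀ n, Function.Bijective
      (Ideal.quotientMap (((maximalIdeal B) ^ n).map g₁) g₁ Ideal.le_comap_map))
    (hb₂ : ∀ n, Function.Bijective
      (Ideal.quotientMap (((maximalIdeal C) ^ n).map g₂) g₂ Ideal.le_comap_map))
    (𝔑 : Ideal (l' ⊗[l] B)) [𝔑.IsPrime] (h𝔑 : (maximalIdeal B).map (tensorInr l l' B) ≤ 𝔑) :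
    ∃ (𝔑' : Ideal (l' ⊗[l] C)) (_ : 𝔑'.IsPrime), (maximalIdeal C).map (tensorInr l l' C) ≤ 𝔑' ∧
      (𝔑.IsMaximal → 𝔑'.IsMaximal) ∧
      (Function.Surjective (algebraMap l' ((l' ⊗[l] B) ⧸ 𝔑)) →
        Function.Surjective (algebraMap l' ((l' ⊗[l] C) ⧸ 𝔑'))) ∧
      ∃ ε : LocalCpl (Localization.AtPrime 𝔑) ≃+* LocalCpl (Localization.AtPrime 𝔑'),
        ∀ c : l', ε (AdicCompletion.of _ _ (algebraMap l' _ c)) =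
          AdicCompletion.of _ _ (algebraMap l' _ c) := by
  -- `R̂` as an `l`-algebra through `C`; `g₁`, `g₂` as `l`-algebra maps
  letI : Algebra l Rh := (g₂.comp (algebraMap l C)).toAlgebra
  let g₂' : C →ₐ[l] Rh := { g₂ with commutes' := fun _ => rfl }
  let g₁' : B →ₐ[l] Rh := { g₁ with commutes' := fun c => hcomp c }
  set G₁ := (Algebra.TensorProduct.map (AlgHom.id l' l') g₁').toRingHom with hG₁
  set G₂ := (Algebra.TensorProduct.map (AlgHom.id l' l') g₂').toRingHom with hG₂
  set IB := (maximalIdeal B).map (tensorInr l l' B) with hIB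
  set IC := (maximalIdeal C).map (tensorInr l l' C) with hIC
  set J := (maximalIdeal Rh).map (tensorInr l l' Rh) with hJdef
  obtain ⟨hIBJ, HB⟩ := levelBijective_baseChange_maximalIdeal l' g₁' h₁ hb₁
  obtain ⟨hICJ, HC⟩ := levelBijective_baseChange_maximalIdeal l' g₂' h₂ hb₂
  -- the prime `𝔐` of `l' ⊗ R̂` over `𝔑`, and `𝔑' = G₂⁻¹ 𝔐`
  obtain ⟨𝔐, h𝔐p, hJ𝔐, rfl, hmax⟩ := exists_isPrime_comap_eq_of_levelBijective G₁ IB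
    (levelOne_bijective_of_levelBijective G₁ IB HB) 𝔑 h𝔑
  haveI := h𝔐p
  have hJ𝔐' : IC.map G₂ ≤ 𝔐 := by rw [hICJ, ← hIBJ]; exact hJ𝔐
  haveI : (𝔐.comap G₂).IsPrime := Ideal.comap_isPrime G₂ 𝔐
  refine ⟨𝔐.comap G₂, inferInstance, ?_, fun hm => ?_, fun hs => ?_, ?_⟩
  · rw [← Ideal.map_le_iff_le_comap]; exact hJ𝔐'
  · haveI : 𝔐.IsMaximal := hmax hm
    exact isMaximal_comap_of_levelBijective G₂ IC (levelOne_bijective_of_levelBijective G₂ IC HC) 𝔐 hJ𝔐'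
  · have hJ𝔐'' : IB.map G₁ ≤ 𝔐 := hJ𝔐
    have hsurj := (surjective_and_ker_mk_comp_of_levelOne G₁ IB
      (levelOne_bijective_of_levelBijective G₁ IB HB)).1
    exact surjective_algebraMap_quotient_comap_of_surjective l'
      (Algebra.TensorProduct.map (AlgHom.id l' l') g₁') (Algebra.TensorProduct.map (AlgHom.id l' l') g₂')
      𝔐 hJ𝔐'' hsurj hs
  -- the localized level-bijective pair
  set F₁ := Localization.localRingHom (𝔐.comap G₁) 𝔐 G₁ rfl with hF₁
  set F₂ := Localization.localRingHom (𝔐.comap G₂) 𝔐 G₂ rfl with hF₂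
  have L₁ := levelBijective_localization G₁ IB HB 𝔐 hJ𝔐
  have L₂ := levelBijective_localization G₂ IC HC 𝔐 hJ𝔐'
  have hF₁a : ∀ s, F₁ (algebraMap _ (Localization.AtPrime (𝔐.comap G₁)) s) =
      algebraMap _ (Localization.AtPrime 𝔐) (G₁ s) := fun s =>
    Localization.localRingHom_to_map _ _ _ rfl s
  have hF₂a : ∀ s, F₂ (algebraMap _ (Localization.AtPrime (𝔐.comap G₂)) s) =
      algebraMap _ (Localization.AtPrime 𝔐) (G₂ s) := fun s =>
    Localization.localRingHom_to_map _ _ _ rfl s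
  have hI₁ : IB.map (algebraMap _ (Localization.AtPrime (𝔐.comap G₁))) ≤
      maximalIdeal (Localization.AtPrime (𝔐.comap G₁)) := by
    rw [← Localization.AtPrime.map_eq_maximalIdeal]
    exact Ideal.map_mono h𝔑
  have hI₂ : IC.map (algebraMap _ (Localization.AtPrime (𝔐.comap G₂))) ≤
      maximalIdeal (Localization.AtPrime (𝔐.comap G₂)) := by
    rw [← Localization.AtPrime.map_eq_maximalIdeal]
    exact Ideal.map_mono (Ideal.map_le_iff_le_comap.mp hJ𝔐')
  have hIBJ' : IB.map G₁ = J := hIBJ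
  have hICJ' : IC.map G₂ = J := hICJ
  have e₁ : F₁.comp (algebraMap _ (Localization.AtPrime (𝔐.comap G₁))) =
      (algebraMap _ (Localization.AtPrime 𝔐)).comp G₁ := RingHom.ext fun s => hF₁a s
  have e₂ : F₂.comp (algebraMap _ (Localization.AtPrime (𝔐.comap G₂))) =
      (algebraMap _ (Localization.AtPrime 𝔐)).comp G₂ := RingHom.ext fun s => hF₂a s
  have hJ' : (IB.map (algebraMap _ (Localization.AtPrime (𝔐.comap G₁)))).map F₁ =
      (IC.map (algebraMap _ (Localization.AtPrime (𝔐.comap G₂)))).map F₂ := by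
    rw [Ideal.map_map _ F₁, Ideal.map_map _ F₂, e₁, e₂, ← Ideal.map_map G₁, ← Ideal.map_map G₂,
      hIBJ', hICJ']
  obtain ⟨ε, hε⟩ := exists_localCpl_equiv_of_levelBijective_pair F₁ F₂ hI₁ hI₂ hJ' L₁ L₂
  refine ⟨ε, fun c => hε _ _ ?_⟩
  rw [IsScalarTower.algebraMap_apply l' (l' ⊗[l] B) (Localization.AtPrime (𝔐.comap G₁)),
    IsScalarTower.algebraMap_apply l' (l' ⊗[l] C) (Localization.AtPrime (𝔐.comap G₂)), hF₁a, hF₂a,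
    Algebra.TensorProduct.algebraMap_apply, Algebra.TensorProduct.algebraMap_apply, hG₁, hG₂,
    AlgHom.toRingHom_eq_coe, AlgHom.toRingHom_eq_coe, RingHom.coe_coe, RingHom.coe_coe,
    Algebra.TensorProduct.map_tmul, Algebra.TensorProduct.map_tmul, map_one, map_one]

end Main

end Summit.ResolutionOfSingularities.ResolutionOfSingularities.Theorems

end
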